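import Summits.Ventures.PercRepro.C025ProfilePLDBridgeArith
import Summits.Ventures.PercRepro.C025ProfileTwoFlatModel
import Summits.Ventures.PercRepro.C025ProfileShiftedRow

/-!
# PER-LAYER DOMINANCE OF A MATROID GIVES EVERY ROW OF `M ⊕ U_{m,m}` (night-3 g27)

`proofs/NIGHT3-G27-PLD.md` §3.  For a finite matroid `M` and a finite set `E₃` of free points disjoint from its ground set,
the disjoint sum `M ⊕ freeOn E₃` has rank `ρ(X ∩ E_M) + |X ∩ E₃|` (`eRk_disjointSum_freeOn`).  Its members of rank `q`
fibre over `I = B ∩ E_M` with at most `C(m, q − ρ(I))` members per fibre, each priced `C(p, u−q)/C(u,q)·[u ≤ p]` with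
`p = ρ(E_M ∖ I) + (m − (q − ρ(I)))` (`card_fibre_le`, `price_eq_fibre`), and its level `u` contains the `C(m, u − ρ(J))`
sets `J ⊔ Y` (`card_levelSet_ge`).  With the abstract bridge `PLDBridge.rows_of_pld`: PER-LAYER DOMINANCE of `M` —
`Σ_{I ⊆ E_M : lo ≤ ρ(I) ≤ hi, Θ ≤ ρ(E_M∖I) + ρ(I)} C(ρ(E_M∖I), δ) ≤ Σ_{I : lo+δ ≤ ρ(E_M∖I) ≤ hi+δ} C(ρ(E_M∖I), δ)` for all
`lo, hi, δ` and `Θ ≤ lo+hi+δ` with `lo = 0` or `Θ = lo+hi+δ` — implies every row `(q, u)` of (Π) on `M ⊕ freeOn E₃`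
(`profileIneq_disjointSum_freeOn_of_pld`), for every `m = #E₃`.  (PLD) holds on every matroid on ≤ 8 elements
(census); this module makes it the exact hypothesis behind the rows of «any matroid plus free points».
No `def`, no `instance`, no notation.  Axioms: standard.
-/

open scoped Matroid

namespace PercRepro

open Finset ThmH

namespace PLDBridge

variable {α : Type} [DecidableEq α]

omit [DecidableEq α] in
/-- The disjoint sum of a finite matroid with the free matroid on a finite set is finite (a theorem, not an instance). -/
theorem disjointSum_freeOn_finite (M : Matroid α) [M.Finite] (E₃ : Finset α) (h : Disjoint M.E (E₃ : Set α)) :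
    (M.disjointSum (Matroid.freeOn (E₃ : Set α)) h).Finite :=
  ⟨by rw [Matroid.disjointSum_ground_eq, Matroid.freeOn_ground]; exact M.ground_finite.union E₃.finite_toSet⟩

/-- The ground set of the sum, as a finset. -/
theorem gr_disjointSum_freeOn (M : Matroid α) [M.Finite] (E₃ : Finset α) (h : Disjoint M.E (E₃ : Set α)) :
    haveI := disjointSum_freeOn_finite M E₃ h
    gr (M.disjointSum (Matroid.freeOn (E₃ : Set α)) h) = gr M ∪ E₃ := by
  haveI := disjointSum_freeOn_finite M E₃ h
  apply Finset.coe_injective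
  rw [coe_gr, Matroid.disjointSum_ground_eq, Matroid.freeOn_ground, coe_union, coe_gr]

/-- The rank of a subset of the sum: `ρ_M(X ∩ E_M) + |X ∩ E₃|`. -/
theorem eRk_disjointSum_freeOn (M : Matroid α) [M.Finite] (E₃ : Finset α) (h : Disjoint M.E (E₃ : Set α))
    (X : Finset α) :
    (M.disjointSum (Matroid.freeOn (E₃ : Set α)) h).eRk (X : Set α) =
      M.eRk ((X ∩ gr M : Finset α) : Set α) + ((X ∩ E₃).card : ℕ∞) := by
  rw [SecondRow.eRk_disjointSum, Matroid.freeOn_ground, ← coe_gr M, ← coe_inter, ← coe_inter,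
    Matroid.eRk_freeOn (inter_subset_right), Set.encard_coe_eq_coe_finsetCard]

/-- A rank-`q` member `B` of the sum, split: `I = B ∩ E_M`, `Z = B ∩ E₃`, with `ρ(I) + #Z = q`, and the complement of rank
`ρ(E_M ∖ I) + (m − #Z)`. -/
theorem member_split (M : Matroid α) [M.Finite] (E₃ : Finset α) (h : Disjoint M.E (E₃ : Set α)) {q : ℕ} {B : Finset α}
    (hB : haveI := disjointSum_freeOn_finite M E₃ h
      B ∈ Profile.Rq (M.disjointSum (Matroid.freeOn (E₃ : Set α)) h) q) :
    haveI := disjointSum_freeOn_finite M E₃ h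
    B ⊆ gr M ∪ E₃ ∧ M.eRk ((B ∩ gr M : Finset α) : Set α) + ((B ∩ E₃).card : ℕ∞) = (q : ℕ∞) ∧
      (M.disjointSum (Matroid.freeOn (E₃ : Set α)) h).eRk
        ((gr (M.disjointSum (Matroid.freeOn (E₃ : Set α)) h) \ B : Finset α) : Set α) =
        M.eRk ((gr M \ (B ∩ gr M) : Finset α) : Set α) + ((E₃.card - (B ∩ E₃).card : ℕ) : ℕ∞) := by
  haveI := disjointSum_freeOn_finite M E₃ h
  rw [Profile.mem_Rq, gr_disjointSum_freeOn] at hB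
  obtain ⟨hBg, hBq⟩ := hB
  rw [eRk_disjointSum_freeOn] at hBq
  refine ⟨hBg, hBq, ?_⟩
  rw [gr_disjointSum_freeOn, eRk_disjointSum_freeOn]
  have hdisj : Disjoint (gr M) E₃ := by
    rw [← disjoint_coe, coe_gr]; exact h
  have e1 : (gr M ∪ E₃) \ B ∩ gr M = gr M \ (B ∩ gr M) := by
    ext x; simp only [mem_inter, mem_sdiff, mem_union]; tauto
  have e2 : (gr M ∪ E₃) \ B ∩ E₃ = E₃ \ (B ∩ E₃) := by
    ext x; simp only [mem_inter, mem_sdiff, mem_union]; tauto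
  rw [e1, e2, card_sdiff_of_subset inter_subset_right]

/-- At most `C(m, q − ρ(I))` members of rank `q` have `B ∩ E_M = I` (`ρ(I) = (M.eRk I).toNat`). -/
theorem card_fibre_le (M : Matroid α) [M.Finite] (E₃ : Finset α) (h : Disjoint M.E (E₃ : Set α)) (q : ℕ)
    (I : Finset α) :
    haveI := disjointSum_freeOn_finite M E₃ h
    ((Profile.Rq (M.disjointSum (Matroid.freeOn (E₃ : Set α)) h) q).filter (fun B => B ∩ gr M = I)).card ≤
      E₃.card.choose (q - (M.eRk (I : Set α)).toNat) := by
  haveI := disjointSum_freeOn_finite M E₃ h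
  rw [← card_powersetCard]
  apply card_le_card_of_injOn (fun B => B ∩ E₃)
  · intro B hB
    rw [coe_filter, Set.mem_setOf_eq] at hB
    obtain ⟨hBq, hBI⟩ := hB
    obtain ⟨-, hrk, -⟩ := member_split M E₃ h hBq
    rw [hBI] at hrk
    rw [mem_coe, mem_powersetCard]
    refine ⟨inter_subset_right, ?_⟩
    have hfin : M.eRk (I : Set α) ≠ ⊤ := by
      have := M.eRk_le_eRank (I : Set α)
      exact ne_top_of_le_ne_top (M.eRank_ne_top_iff.2 inferInstance) this
    obtain ⟨r, hr⟩ : ∃ r : ℕ, M.eRk (I : Set α) = (r : ℕ∞) := ⟨_, (ENat.coe_toNat hfin).symm⟩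
    rw [hr, ENat.toNat_coe]
    rw [hr] at hrk
    have : r + (B ∩ E₃).card = q := by exact_mod_cast hrk
    show (B ∩ E₃).card = q - r
    omega
  · intro B hB B' hB' hBB'
    rw [coe_filter, Set.mem_setOf_eq] at hB hB'
    obtain ⟨hBq, hBI⟩ := hB
    obtain ⟨hBq', hBI'⟩ := hB'
    obtain ⟨hBg, -, -⟩ := member_split M E₃ h hBq
    obtain ⟨hBg', -, -⟩ := member_split M E₃ h hBq'
    have e : ∀ C : Finset α, C ⊆ gr M ∪ E₃ → C = C ∩ gr M ∪ C ∩ E₃ := by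
      intro C hC
      rw [← inter_union_distrib_left]
      exact (inter_eq_left.2 hC).symm
    simp only at hBB'
    rw [e B hBg, e B' hBg', hBI, hBI', hBB']

/-- The level `u` of the sum contains at least `C(m, u − ρ(J))` sets with `S ∩ E_M = J` (`ρ(J) ≤ u`). -/
theorem card_levelSet_fibre_ge (M : Matroid α) [M.Finite] (E₃ : Finset α) (h : Disjoint M.E (E₃ : Set α)) (u : ℕ)
    (J : Finset α) (hJ : J ⊆ gr M) (hJu : (M.eRk (J : Set α)).toNat ≤ u) :
    haveI := disjointSum_freeOn_finite M E₃ h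
    E₃.card.choose (u - (M.eRk (J : Set α)).toNat) ≤
      ((Shadow.levelSet (M.disjointSum (Matroid.freeOn (E₃ : Set α)) h) u).filter (fun S => S ∩ gr M = J)).card := by
  haveI := disjointSum_freeOn_finite M E₃ h
  have hdisj : Disjoint (gr M) E₃ := by
    rw [← disjoint_coe, coe_gr]; exact h
  have hfin : M.eRk (J : Set α) ≠ ⊤ := by
    have := M.eRk_le_eRank (J : Set α)
    exact ne_top_of_le_ne_top (M.eRank_ne_top_iff.2 inferInstance) this
  obtain ⟨r, hr⟩ : ∃ r : ℕ, M.eRk (J : Set α) = (r : ℕ∞) := ⟨_, (ENat.coe_toNat hfin).symm⟩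
  rw [hr, ENat.toNat_coe] at hJu ⊢
  have e1 : ∀ Y : Finset α, Y ⊆ E₃ → (J ∪ Y) ∩ gr M = J := by
    intro Y hY
    rw [union_inter_distrib_right, inter_eq_left.2 hJ,
      disjoint_iff_inter_eq_empty.1 (disjoint_of_subset_left hY hdisj.symm), union_empty]
  have e2 : ∀ Y : Finset α, Y ⊆ E₃ → (J ∪ Y) ∩ E₃ = Y := by
    intro Y hY
    rw [union_inter_distrib_right, inter_eq_left.2 hY,
      disjoint_iff_inter_eq_empty.1 (disjoint_of_subset_left hJ hdisj), empty_union]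
  rw [← card_powersetCard]
  apply card_le_card_of_injOn (fun Y => J ∪ Y)
  · intro Y hY
    rw [mem_coe, mem_powersetCard] at hY
    obtain ⟨hYE, hYc⟩ := hY
    rw [coe_filter, Set.mem_setOf_eq, Profile.mem_levelSet, gr_disjointSum_freeOn, eRk_disjointSum_freeOn,
      e1 Y hYE, e2 Y hYE, hr, hYc]
    refine ⟨⟨union_subset_union hJ hYE, ?_⟩, rfl⟩
    rw [← Nat.cast_add, Nat.add_sub_cancel' hJu]
  · intro Y hY Y' hY' hYY'
    rw [mem_coe, mem_powersetCard] at hY hY'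
    have := congrArg (fun S => S ∩ E₃) hYY'
    simp only at this
    rwa [e2 Y hY.1, e2 Y' hY'.1] at this

/-- **PER-LAYER DOMINANCE OF `M` GIVES EVERY ROW `(q, u)` OF `M ⊕ U_{m,m}`** (`q < u`, any finite `M`, any finite
`E₃` disjoint from `E_M`; `ρ(I) = (M.eRk I).toNat`, the corank `ρ(E_M ∖ I)` likewise). -/
theorem profileIneq_disjointSum_freeOn_of_pld (M : Matroid α) [M.Finite] (E₃ : Finset α)
    (h : Disjoint M.E (E₃ : Set α)) {q u : ℕ} (hqu : q < u)
    (hPLD : ∀ lo hi δ Θ : ℕ, Θ ≤ lo + hi + δ → (lo = 0 ∨ lo + hi + δ ≤ Θ) →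
      (∑ I ∈ (gr M).powerset, (if lo ≤ (M.eRk (I : Set α)).toNat ∧ (M.eRk (I : Set α)).toNat ≤ hi ∧
          Θ ≤ (M.eRk ((gr M \ I : Finset α) : Set α)).toNat + (M.eRk (I : Set α)).toNat then
          ((M.eRk ((gr M \ I : Finset α) : Set α)).toNat).choose δ else 0)) ≤
        ∑ I ∈ (gr M).powerset, (if lo + δ ≤ (M.eRk ((gr M \ I : Finset α) : Set α)).toNat ∧
          (M.eRk ((gr M \ I : Finset α) : Set α)).toNat ≤ hi + δ then
          ((M.eRk ((gr M \ I : Finset α) : Set α)).toNat).choose δ else 0)) :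
    haveI := disjointSum_freeOn_finite M E₃ h
    Profile.ProfileIneq (M.disjointSum (Matroid.freeOn (E₃ : Set α)) h) q u := by
  haveI := disjointSum_freeOn_finite M E₃ h
  unfold Profile.ProfileIneq
  set N := M.disjointSum (Matroid.freeOn (E₃ : Set α)) h with hN
  set m := E₃.card with hm
  have hCpos : (0 : ℚ) < (u.choose q : ℚ) := by exact_mod_cast Nat.choose_pos hqu.le
  have hfin : ∀ I : Finset α, M.eRk (I : Set α) ≠ ⊤ := by
    intro I
    have := M.eRk_le_eRank (I : Set α)
    exact ne_top_of_le_ne_top (M.eRank_ne_top_iff.2 inferInstance) this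
  have hcast : ∀ I : Finset α, M.eRk (I : Set α) = (((M.eRk (I : Set α)).toNat : ℕ) : ℕ∞) :=
    fun I => (ENat.coe_toNat (hfin I)).symm
  -- (a) the members, fibred by `I = B ∩ E_M`
  have hmaps : ∀ B ∈ Profile.Rq N q, B ∩ gr M ∈ (gr M).powerset := by
    intro B _
    rw [mem_powerset]; exact inter_subset_right
  have hprice : ∀ B ∈ Profile.Rq N q,
      Profile.price N q u B =
        (if (M.eRk ((B ∩ gr M : Finset α) : Set α)).toNat ≤ q ∧
            u ≤ (M.eRk ((gr M \ (B ∩ gr M) : Finset α) : Set α)).toNat +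
              (m - (q - (M.eRk ((B ∩ gr M : Finset α) : Set α)).toNat)) then
          (((M.eRk ((gr M \ (B ∩ gr M) : Finset α) : Set α)).toNat +
              (m - (q - (M.eRk ((B ∩ gr M : Finset α) : Set α)).toNat))).choose (u - q) : ℚ) / (u.choose q : ℚ)
        else 0) := by
    intro B hB
    obtain ⟨-, hrk, hcompl⟩ := member_split M E₃ h hB
    rw [hcast (B ∩ gr M)] at hrk
    rw [hcast (gr M \ (B ∩ gr M))] at hcompl
    have hrk' : (M.eRk ((B ∩ gr M : Finset α) : Set α)).toNat + (B ∩ E₃).card = q := by exact_mod_cast hrk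
    have hcompl' : N.eRk ((gr N \ B : Finset α) : Set α) =
        (((M.eRk ((gr M \ (B ∩ gr M) : Finset α) : Set α)).toNat +
          (m - (q - (M.eRk ((B ∩ gr M : Finset α) : Set α)).toNat)) : ℕ) : ℕ∞) := by
      rw [hcompl, ← Nat.cast_add]
      congr 1
      omega
    by_cases hup : u ≤ (M.eRk ((gr M \ (B ∩ gr M) : Finset α) : Set α)).toNat +
        (m - (q - (M.eRk ((B ∩ gr M : Finset α) : Set α)).toNat))
    · rw [PriceMono.price_eq_of_le hcompl' hup, if_pos ⟨by omega, hup⟩]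
      exact ShiftedRow.choose_div_choose_eq_choose_div' hqu.le
    · rw [if_neg (fun h' => hup h'.2)]
      unfold Profile.price
      rw [hcompl', if_neg (by exact_mod_cast hup)]
  have hA : ∑ B ∈ Profile.Rq N q, Profile.price N q u B ≤
      (((∑ I ∈ (gr M).powerset,
        (if (M.eRk (I : Set α)).toNat ≤ q ∧
            u ≤ (M.eRk ((gr M \ I : Finset α) : Set α)).toNat + (m - (q - (M.eRk (I : Set α)).toNat)) then
          m.choose (q - (M.eRk (I : Set α)).toNat) *
            ((M.eRk ((gr M \ I : Finset α) : Set α)).toNat + (m - (q - (M.eRk (I : Set α)).toNat))).choose (u - q)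
        else 0)) : ℕ) : ℚ) / (u.choose q : ℚ) := by
    rw [← sum_fiberwise_of_maps_to hmaps, Nat.cast_sum, sum_div]
    apply sum_le_sum
    intro I _
    have hw : ∀ B ∈ (Profile.Rq N q).filter (fun B => B ∩ gr M = I), Profile.price N q u B =
        (if (M.eRk (I : Set α)).toNat ≤ q ∧
            u ≤ (M.eRk ((gr M \ I : Finset α) : Set α)).toNat + (m - (q - (M.eRk (I : Set α)).toNat)) then
          (((M.eRk ((gr M \ I : Finset α) : Set α)).toNat + (m - (q - (M.eRk (I : Set α)).toNat))).choose (u - q) : ℚ) /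
            (u.choose q : ℚ)
        else 0) := by
      intro B hB
      rw [mem_filter] at hB
      rw [hprice B hB.1, hB.2]
    rw [sum_congr rfl hw, sum_const, nsmul_eq_mul]
    have hc := card_fibre_le M E₃ h q I
    split_ifs with hcond
    · rw [Nat.cast_mul, mul_div_assoc]
      exact mul_le_mul_of_nonneg_right (by exact_mod_cast hc) (by positivity)
    · rw [mul_zero, Nat.cast_zero, zero_div]
  -- (b) the level `u`, fibred by `J = S ∩ E_M`
  have hmaps' : ∀ S ∈ Shadow.levelSet N u, S ∩ gr M ∈ (gr M).powerset := by
    intro S _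
    rw [mem_powerset]; exact inter_subset_right
  have hC : (((∑ J ∈ (gr M).powerset,
      (if (M.eRk (J : Set α)).toNat ≤ u then m.choose (u - (M.eRk (J : Set α)).toNat) else 0)) : ℕ) : ℚ) ≤
      ((Shadow.levelSet N u).card : ℚ) := by
    rw [card_eq_sum_card_fiberwise (fun S hS => mem_coe.2 (hmaps' S (mem_coe.1 hS)))]
    push_cast
    apply sum_le_sum
    intro J hJ
    rw [mem_powerset] at hJ
    split_ifs with hJu
    · exact_mod_cast card_levelSet_fibre_ge M E₃ h u J hJ hJu
    · exact_mod_cast Nat.zero_le _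
  -- (c) the arithmetic core: the abstract bridge on `(gr M).powerset` with `c = ρ`, `f = ρ(E_M ∖ ·)`
  have hT := rows_of_pld (gr M).powerset (fun I => (M.eRk (I : Set α)).toNat)
    (fun I => (M.eRk ((gr M \ I : Finset α) : Set α)).toNat) m q u hqu hPLD
  -- the right side of the core is the level count through `I ↦ E_M ∖ I`
  have hR : (∑ I ∈ (gr M).powerset,
      (if (M.eRk ((gr M \ I : Finset α) : Set α)).toNat ≤ u then
        m.choose (u - (M.eRk ((gr M \ I : Finset α) : Set α)).toNat) else 0)) =
      ∑ J ∈ (gr M).powerset, (if (M.eRk (J : Set α)).toNat ≤ u then m.choose (u - (M.eRk (J : Set α)).toNat) else 0) := by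
    apply sum_nbij' (fun I => gr M \ I) (fun J => gr M \ J)
    · intro I hI; rw [mem_powerset]; exact sdiff_subset
    · intro J hJ; rw [mem_powerset]; exact sdiff_subset
    · intro I hI; rw [mem_powerset] at hI; exact Finset.sdiff_sdiff_eq_self hI
    · intro J hJ; rw [mem_powerset] at hJ; exact Finset.sdiff_sdiff_eq_self hJ
    · intro I _; rfl
  rw [hR] at hT
  have hT' : (((∑ I ∈ (gr M).powerset,
        (if (M.eRk (I : Set α)).toNat ≤ q ∧
            u ≤ (M.eRk ((gr M \ I : Finset α) : Set α)).toNat + (m - (q - (M.eRk (I : Set α)).toNat)) then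
          m.choose (q - (M.eRk (I : Set α)).toNat) *
            ((M.eRk ((gr M \ I : Finset α) : Set α)).toNat + (m - (q - (M.eRk (I : Set α)).toNat))).choose (u - q)
        else 0)) : ℕ) : ℚ) / (u.choose q : ℚ) ≤
      (((∑ J ∈ (gr M).powerset,
        (if (M.eRk (J : Set α)).toNat ≤ u then m.choose (u - (M.eRk (J : Set α)).toNat) else 0)) : ℕ) : ℚ) := by
    rw [div_le_iff₀ hCpos]
    have : (((∑ I ∈ (gr M).powerset,
        (if (M.eRk (I : Set α)).toNat ≤ q ∧
            u ≤ (M.eRk ((gr M \ I : Finset α) : Set α)).toNat + (m - (q - (M.eRk (I : Set α)).toNat)) then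
          m.choose (q - (M.eRk (I : Set α)).toNat) *
            ((M.eRk ((gr M \ I : Finset α) : Set α)).toNat + (m - (q - (M.eRk (I : Set α)).toNat))).choose (u - q)
        else 0)) : ℕ) : ℚ) ≤
        ((u.choose q * ∑ J ∈ (gr M).powerset,
          (if (M.eRk (J : Set α)).toNat ≤ u then m.choose (u - (M.eRk (J : Set α)).toNat) else 0) : ℕ) : ℚ) := by
      exact_mod_cast hT
    rw [Nat.cast_mul] at this
    linarith [this]
  linarith [hA, hC, hT']

end PLDBridge

end PercRepro
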